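import Summits.BirchSwinnertonDyer.BirchSwinnertonDyer.Theorems.EdixhovenFibreFiveSevenNonEisensteinWitnessCore
import Literature.NumberTheory.EllipticCurves.TorsionFrobeniusProofs
import Literature.NumberTheory.EllipticCurves.NonEisensteinPrimeOfSurjective
import Literature.NumberTheory.EllipticCurves.GaloisActionProofs
import Literature.NumberTheory.GaloisRepresentations.ChebotarevOpenSubgroup
import Literature.NumberTheory.GaloisRepresentations.ArtinDirichletCoefficients
import Literature.NumberTheory.EllipticCurves.Rank1Residual.Predicates
import HarnessLib

/-!
# A non-Eisenstein witness in a prescribed congruence class: for `E[p]` irreducible (`p` odd) and any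
# modulus `M ≠ 0` there is a good prime `ℓ ≡ 1 (mod M)`, `ℓ ∉ S`, with `a_ℓ(E) ≢ ℓ + 1 (mod p)` — PROVED
# from the tree's Chebotarev theorem (no named fact)

Cell `pub/bsd-wall` (D-0145 line `route-BirchSwinnertonDyer-EdixhovenFibreFiveSeven`), seat `bsd-line-edix-p5`
(prover, width-5 attach). THEOREMS ONLY (no definition, no named fact, no `sorry`); route-free. Serves the
L-TWIST step of cruxes TDS57 (stmt-BirchSwinnertonDyer-22227) / KP57 (stmt-BirchSwinnertonDyer-23810) and AKR's
S57-T: the sibling seat's non-Eisenstein theorem (C-i) (maximal ideal `𝔫_{f,p} ⊂ 𝕋̃` of the prime-to-`S` Hecke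
ring, NOT Eisenstein in the sense of Darmon–Diamond–Taylor p. 120: "`𝔫` is Eisenstein if `T_r ≡ r + 1 mod 𝔫`
for all `r ≡ 1 mod N`") asks for ONE numeral `r₀` — a prime `r₀ ∤ S`, `r₀ ≡ 1 (mod S)`, with
`p ∤ a_{r₀}(E) − (r₀ + 1)`. The tree's `exists_prime_not_dvd_lFunction_sub_of_hasIrreducibleModPGaloisRep`
(`NonEisensteinPrimeOfSurjective`) gives such a prime WITHOUT the congruence; the congruence is the content
here, supplied by Chebotarev's density theorem in `ℚ(E[p], μ_{pM})` — PROVED in the tree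
(`GaloisRepresentations.chebotarevArtinRep_holds`, via `exists_isArithFrobAt_mul_inv_mem_not_mem` for the open
normal subgroup `ker ρ̄_{E,p} ∩ Gal(ℚ̄/ℚ(μ_{pM}))`) — and by the group theory of the CORE sibling file
(`exists_mem_rootsOfUnityFixer_forall_smul_ne`: some `σ ∈ Gal(ℚ̄/ℚ(μ_{pM}))` has no non-zero fixed point on
`E[p]`).

**Theorem** (`exists_prime_modEq_one_not_dvd_frobeniusTrace_sub`). `W/ℚ` globally minimal elliptic, `p` odd,
`E[p]` irreducible, `M ≠ 0`, `S` finite ⟹ a prime `ℓ ∉ S`, `ℓ ≠ p`, `ℓ ∤ M`, of good reduction,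
`ℓ ≡ 1 (mod M)`, `p ∤ a_ℓ(W) − (ℓ + 1)`: a Frobenius `φ` at a good `ℓ ∤ pMΔ`, `ℓ ∉ S`, with `φ ≡ σ` on `E[p]`
and on `μ_{Mp}`; `χ_{Mp}(φ) = ℓ = 1` (`modNCyclotomicCharacter_eq_residueCard_of_isArithFrobAt`); and
`p ∣ #Ẽ(𝔽_ℓ)` would give `φ` a non-zero fixed point on `E[p]` (tree
`exists_frobenius_smul_eq_of_dvd_reductionPointCount_holds`, Silverman VII.3.1 (b)). Any-model / `L`-function
forms: `exists_prime_modEq_one_not_dvd_lFunction_sub`, `…_sub'` (`a_ℓ = W.LFunction ℓ`, `ℓ ∤ N_E`).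

Axioms: `propext`, `Classical.choice`, `Quot.sound`. BSD is not proved by this file; it removes the cite-only
input (a Chebotarev / DDT Lemma 4.12-type fact) that the non-Eisenstein step of L-TWIST would otherwise carry.

References: [DarmonDiamondTaylor1995] §4.3 p. 120, Prop. 2.6 (b), Lemma 4.12; [TateGCFT1967] §2.4;
[SilvermanAEC2009] VII.3.1 (b); [Serre1972] §4.
-/

set_option autoImplicit false
-- the Theorems directory repeats the summit name (sibling precedent `SignedBaseChangeAssembly.lean`)
set_option linter.dupNamespace false

noncomputable section

open scoped Classical

open WeierstrassCurve NumberField IsDedekindDomain Field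
  Literature.NumberTheory.EllipticCurves Literature.NumberTheory.GaloisRepresentations
  Literature.NumberTheory.EllipticCurves.Rank1Residual

namespace Summit.BirchSwinnertonDyer.BirchSwinnertonDyer.Theorems.NonEisensteinWitness

/-! ### §1 The kernel of `ρ̄_{E,p}` -/

/-- `σ ∈ ker ρ̄_{E,n}` iff `σ` fixes `E[n]` pointwise (unfolding of `galoisRepTorsion`; local copy of the
sibling private lemma of `BSDSelmerSmithCasesProofs`). [folklore] -/
theorem mem_ker_galoisRepTorsion_iff (W : WeierstrassCurve ℚ) (n : ℤ) (σ : absoluteGaloisGroup ℚ) :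
    σ ∈ (W.galoisRepTorsion n).ker ↔ ∀ P : geomTorsion W n, σ • P = P := by
  rw [MonoidHom.mem_ker]
  constructor
  · intro h P
    rw [← galoisRepTorsion_apply, h]
    rfl
  · intro h
    refine Multiplicative.toAdd.injective (AddEquiv.ext fun P ↦ ?_)
    rw [galoisRepTorsion_apply]
    exact h P

/-! ### §2 The Frobenius prime: Chebotarev in `ℚ(E[p], μ_{pM})` -/

/-- **A good prime `ℓ ≡ 1 (mod M)` with non-Eisenstein trace `a_ℓ(E) ≢ ℓ + 1 (mod p)`**, outside any
finite set `S`, for a globally minimal `W/ℚ` with `E[p]` irreducible (`p` odd) and any modulus `M ≠ 0`.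
Proof: `σ ∈ Gal(ℚ̄/ℚ(μ_{Mp}))` without fixed points on `E[p]` (`exists_mem_rootsOfUnityFixer_forall_smul_ne`);
Chebotarev for the open normal subgroup `ker ρ̄_{E,p} ∩ Gal(ℚ̄/ℚ(μ_{Mp}))` (tree
`exists_isArithFrobAt_mul_inv_mem_not_mem`, PROVED from `chebotarevArtinRep_holds`) gives a Frobenius `φ` at a
prime `𝔓 ∣ ℓ`, `ℓ ∉ S ∪ {p} ∪ {ℓ ∣ M p Δ_min}`, with `φ ≡ σ` on `E[p]` and `χ_{Mp}(φ) = χ_{Mp}(σ) = 1`; as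
`χ_{Mp}(φ) = ℓ` (`modNCyclotomicCharacter_eq_residueCard_of_isArithFrobAt`), `ℓ ≡ 1 (mod Mp)`; and
`p ∣ a_ℓ − ℓ − 1 = −#Ẽ(𝔽_ℓ)` would make `φ` fix a non-zero point of `E[p]`
(`exists_frobenius_smul_eq_of_dvd_reductionPointCount_holds`, Silverman VII.3.1 (b)) — impossible for `σ`.
[cite: TateGCFT1967, §2.4 (Tchebotarev density theorem)] [cite: DarmonDiamondTaylor1995, Prop. 2.6 (b) and §4.3 p. 120]
[cite: SilvermanAEC2009, Prop. VII.3.1 (b)] -/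
theorem exists_prime_modEq_one_not_dvd_frobeniusTrace_sub (W : WeierstrassCurve ℚ) [W.IsElliptic]
    [W.IsGloballyMinimal] (p : ℕ) [Fact p.Prime] (hp2 : p ≠ 2) (hirr : W.HasIrreducibleModPGaloisRep p)
    {M : ℕ} (hM : M ≠ 0) (S : Set ℕ) (hS : S.Finite) :
    ∃ (ℓ : ℕ) (_ : Fact ℓ.Prime), ℓ ∉ S ∧ ℓ ≠ p ∧ ¬ ℓ ∣ M ∧ W.HasGoodReductionAtPrime ℓ ∧
      ℓ ≡ 1 [MOD M] ∧ ¬ (p : ℤ) ∣ W.frobeniusTrace ℓ - (ℓ + 1) := by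
  have hp : p.Prime := Fact.out
  haveI : NeZero p := ⟨hp.ne_zero⟩
  set M' : ℕ := M * p with hM'def
  have hM'0 : M' ≠ 0 := mul_ne_zero hM hp.ne_zero
  haveI : NeZero M' := ⟨hM'0⟩
  haveI : NeZero (M' : ℚ) := NeZero.charZero
  have hpM' : p ∣ M' := Dvd.intro_left M rfl
  -- the element `σ ∈ Gal(ℚ̄/ℚ(μ_{M'}))` without fixed points on `E[p]`
  obtain ⟨σ, hσH, hσfix⟩ := exists_mem_rootsOfUnityFixer_forall_smul_ne W p hp2 hirr hpM' hM'0
  -- the open normal subgroup `N = ker ρ̄_{E,p} ∩ Gal(ℚ̄/ℚ(μ_{M'}))`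
  set N : Subgroup (absoluteGaloisGroup ℚ) := (W.galoisRepTorsion p).ker ⊓ rootsOfUnityFixer ℚ M'
    with hNdef
  have hHn : (rootsOfUnityFixer ℚ M').Normal := by
    rw [rootsOfUnityFixer_eq_ker]
    exact MonoidHom.normal_ker _
  haveI : N.Normal := Subgroup.normal_inf_normal _ _
  have hNopen : IsOpen (N : Set (absoluteGaloisGroup ℚ)) := by
    rw [hNdef, Subgroup.coe_inf]
    exact (W.isOpen_ker_galoisRepTorsion_holds (n := (p : ℤ)) (by exact_mod_cast hp.ne_zero)).inter
      (isOpen_rootsOfUnityFixer ℚ M')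
  -- the excluded primes: `S`, `p`, the bad primes, the divisors of `M'`
  have hΔ0 : minimalDiscriminantInt W ≠ 0 := minimalDiscriminantInt_ne_zero W
  set T : Set ℕ := S ∪ {ℓ | ℓ = p ∨ (ℓ : ℤ) ∣ minimalDiscriminantInt W ∨ ℓ ∣ M'} with hTdef
  have hT : T.Finite := by
    refine hS.union ((Set.finite_le_nat (max p (max (minimalDiscriminantInt W).natAbs M'))).subset ?_)
    rintro ℓ (rfl | hℓ | hℓ)
    · exact Set.mem_setOf.mpr (le_max_left _ _)
    · exact Set.mem_setOf.mpr (le_max_of_le_right (le_max_of_le_left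
        (Nat.le_of_dvd (Int.natAbs_pos.mpr hΔ0) (Int.natCast_dvd.mp hℓ))))
    · exact Set.mem_setOf.mpr (le_max_of_le_right (le_max_of_le_right
        (Nat.le_of_dvd (Nat.pos_of_ne_zero hM'0) hℓ)))
  -- Chebotarev
  obtain ⟨v, hvB, -, 𝔓, h𝔓, φ, hφ, hφσ⟩ :=
    exists_isArithFrobAt_mul_inv_mem_not_mem ℚ N hNopen σ _ (finite_setOf_place_over T hT)
  obtain ⟨ℓ, hℓ, hℓv⟩ := exists_prime_natCast_mem v
  have hℓT : ℓ ∉ T := fun hmem ↦ hvB (Set.mem_biUnion (x := ℓ) ⟨hmem, hℓ.ne_zero⟩ hℓv)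
  have hℓS : ℓ ∉ S := fun h ↦ hℓT (Or.inl h)
  have hℓp : ℓ ≠ p := fun h ↦ hℓT (Or.inr (Or.inl h))
  have hℓΔ : ¬ (ℓ : ℤ) ∣ minimalDiscriminantInt W := fun h ↦ hℓT (Or.inr (Or.inr (Or.inl h)))
  have hℓM' : ¬ ℓ ∣ M' := fun h ↦ hℓT (Or.inr (Or.inr (Or.inr h)))
  haveI : Fact ℓ.Prime := ⟨hℓ⟩
  have hgood : W.HasGoodReductionAtPrime ℓ := hasGoodReductionAtPrime_of_not_dvd W ℓ hℓΔ
  -- `φ` acts on `E[p]` as `σ` does, and fixes `μ_{M'}`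
  have hφN : φ * σ⁻¹ ∈ (W.galoisRepTorsion p).ker ∧ φ * σ⁻¹ ∈ rootsOfUnityFixer ℚ M' := by
    have h := hφσ
    rw [hNdef, Subgroup.mem_inf] at h
    exact h
  have hφE : ∀ P : geomTorsion W p, φ • P = σ • P := by
    intro P
    have h := (mem_ker_galoisRepTorsion_iff W p _).mp hφN.1 (σ • P)
    rwa [mul_smul, inv_smul_smul] at h
  have hφH : φ ∈ rootsOfUnityFixer ℚ M' := by
    have h := (rootsOfUnityFixer ℚ M').mul_mem hφN.2 hσH
    rwa [inv_mul_cancel_right] at h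
  -- `ℓ ≡ 1 (mod M')`
  have hℓv' : ((Rat.HeightOneSpectrum.primesEquiv v : Nat.Primes) : ℕ) = ℓ :=
    primesEquiv_eq_of_natCast_mem hℓ hℓv
  have hM'v : (M' : 𝓞 ℚ) ∉ v.asIdeal :=
    Rat.natCast_not_mem_asIdeal_of_not_dvd (by rw [hℓv']; exact hℓM')
  have hM'𝔓 : (M' : absIntegers (𝓞 ℚ) ℚ) ∉ 𝔓 := natCast_not_mem_of_mem_primesAbove ℚ hM'v h𝔓
  have hχφ : (modNCyclotomicCharacter ℚ M' φ : ZMod M') = v.residueCard :=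
    modNCyclotomicCharacter_eq_residueCard_of_isArithFrobAt h𝔓 hM'𝔓 hφ
  have hχ1 : modNCyclotomicCharacter ℚ M' φ = 1 := by
    have h := hφH
    rw [rootsOfUnityFixer_eq_ker, MonoidHom.mem_ker] at h
    exact h
  have hres : v.residueCard = ℓ := by
    rw [Rat.residueCard_eq_natGenerator']
    exact hℓv'
  rw [hχ1, Units.val_one, hres] at hχφ
  have hmod' : ℓ ≡ 1 [MOD M'] := by
    have h1 : ((ℓ : ℕ) : ZMod M') = ((1 : ℕ) : ZMod M') := by rw [Nat.cast_one]; exact hχφ.symm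
    exact (ZMod.natCast_eq_natCast_iff ℓ 1 M').mp h1
  have hmod : ℓ ≡ 1 [MOD M] := Nat.ModEq.of_mul_right p hmod'
  refine ⟨ℓ, ⟨hℓ⟩, hℓS, hℓp, fun h ↦ hℓM' (h.mul_right p), hgood, hmod, fun hdvd ↦ ?_⟩
  -- non-Eisenstein: otherwise `φ` fixes a non-zero point of `E[p]`
  have hcnt : p ∣ W.reductionPointCount ℓ := (dvd_frobeniusTrace_sub_iff W p ℓ).mp hdvd
  obtain ⟨P, hP0, hP⟩ :=
    exists_frobenius_smul_eq_of_dvd_reductionPointCount_holds W p ℓ hℓp hgood hcnt v hℓv 𝔓 h𝔓 φ hφ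
  exact hσfix P hP0 (by rw [← hφE P]; exact hP)

/-! ### §3 Any model, `a_ℓ = W.LFunction ℓ` -/

/-- **Any-model form**: for ANY Weierstrass model `W` of `E/ℚ` with `E[p]` irreducible (`p` odd), any
`M ≠ 0` and any finite `S`, there is a prime `ℓ ∉ S`, `ℓ ≠ p`, `ℓ ∤ M`, `ℓ ∤ N_E`, `ℓ ≡ 1 (mod M)`, with
`a_ℓ(E) ≢ ℓ + 1 (mod p)` for `a_ℓ(E) = W.LFunction ℓ` — transport to a global minimal model
(`hasGlobalMinimalModel_rat_holds`; `Mazur1978.hasIrreducibleModPGaloisRep_smul_iff`, `LFunction_smul`,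
`conductorNorm_smul`, `LFunction_apply_prime_eq_frobeniusTrace`, `not_dvd_conductorNorm_of_hasGoodReductionAtPrime`),
as in the sibling `exists_prime_not_dvd_lFunction_sub_of_hasIrreducibleModPGaloisRep`.
[cite: DarmonDiamondTaylor1995, Prop. 2.6 (b) and §4.3 p. 120] -/
theorem exists_prime_modEq_one_not_dvd_lFunction_sub (W : WeierstrassCurve ℚ) [W.IsElliptic] (p : ℕ)
    [Fact p.Prime] (hp2 : p ≠ 2) (hirr : W.HasIrreducibleModPGaloisRep p) {M : ℕ} (hM : M ≠ 0)
    (S : Set ℕ) (hS : S.Finite) :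
    ∃ ℓ : ℕ, ℓ.Prime ∧ ℓ ∉ S ∧ ℓ ≠ p ∧ ¬ ℓ ∣ M ∧ ¬ ℓ ∣ W.conductorNorm ℤ ∧ ℓ ≡ 1 [MOD M] ∧
      ¬ (p : ℤ) ∣ W.LFunction ℓ - (ℓ + 1) := by
  obtain ⟨C, hC⟩ := hasGlobalMinimalModel_rat_holds W
  haveI := hC
  have hirr₀ : (C • W).HasIrreducibleModPGaloisRep p :=
    (Mazur1978.hasIrreducibleModPGaloisRep_smul_iff W C p).mpr hirr
  obtain ⟨ℓ, hℓF, hℓS, hℓp, hℓM, hgood, hmod, hne⟩ :=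
    exists_prime_modEq_one_not_dvd_frobeniusTrace_sub (C • W) p hp2 hirr₀ hM S hS
  haveI : Fact ℓ.Prime := hℓF
  refine ⟨ℓ, hℓF.out, hℓS, hℓp, hℓM, ?_, hmod, ?_⟩
  · rw [← conductorNorm_smul ℤ W C]
    exact not_dvd_conductorNorm_of_hasGoodReductionAtPrime (C • W) hgood
  · rwa [← LFunction_smul W C, LFunction_apply_prime_eq_frobeniusTrace (C • W) ℓ hgood]

/-- **The numeral `r₀` of the non-Eisenstein step of L-TWIST** (the hypothesis of the sibling theorem
`exists_eigenChar_not_isEisenstein`, Darmon–Diamond–Taylor p. 120): for any model `W` of `E/ℚ` with `E[p]`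
irreducible (`p` odd) and any modulus `S ≠ 0` there is a prime `r₀` with `r₀ ∤ S`, `r₀ ≡ 1 (mod S)`,
`r₀ ∤ N_E`, `r₀ ≠ p` and `p ∤ a_{r₀}(E) − (r₀ + 1)` (`a_{r₀}(E) = W.LFunction r₀`).
[cite: DarmonDiamondTaylor1995, §4.3 p. 120 (Eisenstein maximal ideals)] -/
theorem exists_prime_modEq_one_not_dvd_lFunction_sub' (W : WeierstrassCurve ℚ) [W.IsElliptic] (p : ℕ)
    [Fact p.Prime] (hp2 : p ≠ 2) (hirr : W.HasIrreducibleModPGaloisRep p) {S : ℕ} (hS : S ≠ 0) :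
    ∃ r₀ : ℕ, r₀.Prime ∧ ¬ r₀ ∣ S ∧ r₀ ≡ 1 [MOD S] ∧ ¬ r₀ ∣ W.conductorNorm ℤ ∧ r₀ ≠ p ∧
      ¬ (p : ℤ) ∣ W.LFunction r₀ - (r₀ + 1) := by
  obtain ⟨ℓ, hℓ, -, hℓp, hℓS, hℓN, hmod, hne⟩ :=
    exists_prime_modEq_one_not_dvd_lFunction_sub W p hp2 hirr hS ∅ Set.finite_empty
  exact ⟨ℓ, hℓ, hℓS, hmod, hℓN, hℓp, hne⟩

/-! ### §4 The witness in the shape consumed by the L-TWIST assembly -/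

/-- **The Chebotarev witness `hW` of the L-TWIST assembly, DISCHARGED** — verbatim the hypothesis `hW` of the
sibling `LTwist.lTwist_of_iharaSq_of_witness` (`Theorems/EdixhovenFibreFiveSevenTwistDegreeStepFiveSevenLTwistAssembly.lean`,
p591838): for every globally minimal elliptic `W/ℚ`, odd prime `p` with `Irr W p` and modulus `S ≠ 0` there is a
prime `r₀ ∤ S`, `r₀ ≡ 1 (mod S)`, with `p ∤ a_{r₀}(W) − (r₀ + 1)`. Hence L-TWIST, TDS57 (22227), KP57 (23810)
and AKR's S57-T depend, besides F″, on the single cite-only fact `diamondRibet1997_iharaLemma_sq` (three-copy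
Ihara). [cite: DarmonDiamondTaylor1995, §4.3 p. 120 (Eisenstein maximal ideals)] [cite: TateGCFT1967, §2.4] -/
theorem lTwistWitness :
    ∀ (W : WeierstrassCurve ℚ) [W.IsElliptic] [W.IsGloballyMinimal] (p : ℕ) [Fact p.Prime] (S : ℕ),
      p ≠ 2 → Irr W p → S ≠ 0 →
      ∃ r₀ : ℕ, r₀.Prime ∧ ¬ r₀ ∣ S ∧ r₀ ≡ 1 [MOD S] ∧ ¬ (p : ℤ) ∣ W.LFunction r₀ - (r₀ + 1) := by
  intro W _ _ p _ S hp2 hirr hS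
  obtain ⟨r₀, hr₀, hr₀S, hmod, -, -, hne⟩ := exists_prime_modEq_one_not_dvd_lFunction_sub' W p hp2 hirr hS
  exact ⟨r₀, hr₀, hr₀S, hmod, hne⟩

end Summit.BirchSwinnertonDyer.BirchSwinnertonDyer.Theorems.NonEisensteinWitness

end
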